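import Mathlib
import Summits.Ventures.HodgeRepro2.T5PropGBranchModel
import Summits.Ventures.HodgeRepro2.T5AmiceToy
import Summits.Ventures.HodgeRepro2.T5PadicLinearTopology

/-!
# T5PropGBranchModelToy — a joint-consistency witness for the model branch of Proposition G

Tier-5 support for route-3's §G, in the spirit of README §10.5(ii)(c)/(d) (non-vacuity of the
carriers, joint satisfiability of the displayed hypotheses): `T5PropGBranchModel.ModelData` is
inhabited, and on the instance below the five display-shaped hypotheses of `ModelData.hyps`
([P1] `hsieh`, `local_finite`, `sign`, [P2] `bh`, [P4] `interp`) hold SIMULTANEOUSLY, so that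
`GBranch.Hyps` of t6-p7's T6N5PropG is satisfied by a concrete branch and Proposition G (i)
is instantiated (`toy_cofiniteNonvanishing`).

The instance: Γ⁻ = Γ_𝔭 = ℤ_p, coefficient ring W = ℤ_p (with the dictionary r = p⁻¹), the
Hsieh measure ℒ⁻_{χ,Σ} := δ₀ (the Dirac measure at 0, §70), the unit character ν̃ := 1, the
projection π := id, the character ring 𝒪_{ℂ_p} := ℤ_p itself (so the extension is the identity
extension), the field K := ℚ_p, the complex values L := 1, no places v | 𝔠⁻ (𝔠⁻ = 1), the root
number +1.  Then μ(δ₀) = 0 (§80's `mu_dirac` through `muV_eq_mu`), the three μ-invariants of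
the branch are all 0 (the twist by 1 and the push-forward along id are the identity), and the
interpolation transfer holds because L never vanishes.  It is a toy: nothing here is a Katz
measure or an L-value; it certifies only that the hypotheses of `ModelData.hyps` are
not contradictory and that its conclusion is reachable in the kernel.

§8(d): uses an L-value-free non-vanishing device: NO.
-/

namespace Summit.Ventures.HodgeRepro2.T5PropGBranchModelToy

open Summit.Ventures.HodgeRepro2.T5PropGSkeleton
open Summit.Ventures.HodgeRepro2.T5MeasureSupOnClopens (twist twist_apply)
open Summit.Ventures.HodgeRepro2.T5PushforwardMeasure (pushforward pushforward_apply)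
open Summit.Ventures.HodgeRepro2.T5MuInvariantDVR
open Summit.Ventures.HodgeRepro2.T5AmiceDirac (dirac)
open Summit.Ventures.HodgeRepro2.T5PropGBranchModel
open Summit.Ventures.HodgeRepro2.T6.N5PropG

variable (p : ℕ) [Fact (Nat.Prime p)]

/-- The coercion ℤ_p → ℚ_p is injective. -/
theorem coe_ringHom_injective : Function.Injective (PadicInt.Coe.ringHom (p := p)) :=
  fun _ _ h => Subtype.ext h

/-- The toy model data: W = ℤ_p, Γ⁻ = Γ_𝔭 = ℤ_p, ℒ⁻_{χ,Σ} = δ₀, ν̃ = 1, π = id, the character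
ring ℤ_p, K = ℚ_p, L = 1, no places, root number 1 (places indexed by `Unit`). -/
noncomputable def diracModel : ModelData p ℤ_[p] ℤ_[p] ℤ_[p] ℚ_[p] Unit where
  M := dirac 0
  C := 1
  hC := zero_le_one
  hM := T5AmiceToy.dirac_bound 0
  r := (p : ℝ)⁻¹
  hd := NormDict.padicInt p
  ν := 1
  ν' := 1
  hν := one_mul 1
  π := ContinuousMap.id ℤ_[p]
  hφ _ := le_rfl
  hφi := Function.injective_id
  f := PadicInt.Coe.ringHom
  hf := coe_ringHom_injective p
  L _ := 1
  condMinus := ∅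
  muLoc _ := 0
  rootNumber := 1

/-- The λ⁻¹-branch measure of the toy is δ₀ (the twist by 1 is the identity). -/
theorem diracModel_Mlam : (diracModel p).Mlam = dirac 0 := by
  apply LinearMap.ext
  intro φ
  show (twist (1 : C(ℤ_[p], ℤ_[p])) (dirac 0)) φ = dirac 0 φ
  rw [twist_apply, one_mul]

/-- The 𝔭-line measure of the toy is δ₀ (the push-forward along `id` is the identity). -/
theorem diracModel_Mp : (diracModel p).Mp = dirac 0 := by
  apply LinearMap.ext
  intro φ
  show (pushforward (ContinuousMap.id ℤ_[p]) (diracModel p).Mlam) φ = dirac 0 φ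
  rw [diracModel_Mlam, pushforward_apply, ContinuousMap.comp_id]

/-- `μ(δ₀) = 0` in the DVR vocabulary (§80's `mu_dirac`). -/
theorem muV_dirac_zero : muV (dirac (0 : ℤ_[p]) : C(ℤ_[p], ℤ_[p]) →ₗ[ℤ_[p]] ℤ_[p]) = 0 := by
  rw [muV_eq_mu]
  exact T5AmiceToy.mu_dirac 0

/-- [P1]'s shape on the toy: `W(χ̌) = 1 → μ(ℒ⁻) = Σ_{v|𝔠⁻} μ_p(χ_v)` with 𝔠⁻ = 1, both sides 0. -/
theorem toy_hsieh :
    (diracModel p).rootNumber = 1 →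
      muV (diracModel p).M = ∑ v ∈ (diracModel p).condMinus, (diracModel p).muLoc v := by
  intro _
  simp only [diracModel, Finset.sum_empty]
  exact muV_dirac_zero p

/-- [P2]'s shape on the toy: `μ(L⁻_{Σ,λ⁻¹}) = μ(L⁻_{Σ,λ⁻¹,𝔭})`, both sides `μ(δ₀)`. -/
theorem toy_bh : muV (diracModel p).Mlam = muV (diracModel p).Mp := by
  rw [diracModel_Mlam, diracModel_Mp]

/-- [P4]'s shape on the toy: the interpolation transfer holds since `L = 1` never vanishes. -/
theorem toy_interp :
    InterpolationTransfer (T5PropGBranchMeasure.branchData (diracModel p).E (diracModel p).L) :=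
  fun _ _ => one_ne_zero

/-- JOINT CONSISTENCY: the five display-shaped hypotheses of `ModelData.hyps` hold at once on the
toy, hence `GBranch.Hyps` for its branch. -/
theorem toy_hyps : (diracModel p).toBranch.Hyps :=
  (diracModel p).hyps (toy_hsieh p) (fun _ h => absurd h (Finset.notMem_empty _)) rfl (toy_bh p)
    (toy_interp p)

/-- Proposition G (i) on the toy branch: the complex values vanish on a finite set (here: none). -/
theorem toy_cofiniteNonvanishing : {ν | (diracModel p).L ν = 0}.Finite :=
  (diracModel p).cofiniteNonvanishing (toy_hsieh p) (fun _ h => absurd h (Finset.notMem_empty _)) rfl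
    (toy_bh p) (toy_interp p)

/-- The toy's 𝔭-line measure is non-zero (δ₀ ≠ 0), as `ModelData.Mp_ne_zero` predicts. -/
theorem toy_Mp_ne_zero : (diracModel p).Mp ≠ 0 := by
  rw [diracModel_Mp]
  exact T5AmiceToy.dirac_ne_zero 0

/-- `ModelData` is inhabited. -/
theorem nonempty_modelData : Nonempty (ModelData p ℤ_[p] ℤ_[p] ℤ_[p] ℚ_[p] Unit) := ⟨diracModel p⟩

end Summit.Ventures.HodgeRepro2.T5PropGBranchModelToy
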